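import Literature.Analysis.FluidPDE.SteadyNSLiouville

/-!
# Wang–Yang 2026, Thm 1.5 reduces to Seregin–Wang's `q = 3` annular criterion — proofs

Sibling of `Literature/Analysis/FluidPDE/SteadyNSLiouville.lean` (named facts).  We PROVE the
measure-theoretic half of Wang–Yang's argument (arXiv:2608.06040, proof of Prop. 1.4, p. 20,
(4.8)–(4.11), and proof of Thm 1.5, p. 21): under the decay `u(x) → 0` (`|x| → ∞`) and the
log-improved cylindrical bound (1.13) `|u(x)| ≤ C r^{-2/3} [log(e + r)]^{-γ}` (`r = |x'| ≥ 1`,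
`γ > 1/3`), Seregin–Wang's annular quantity `M(R) = R^{-1/3} ‖u‖_{L³(B_R ∖ B_{R/2})}`
(`sereginWangL3`) tends to `0` as `R → ∞`; hence `lim inf M = 0` and Seregin–Wang's Theorem 1.1
(case `q = ℓ = 3`, the named fact `sereginWang_liouville_L3_annulus`) forces `u ≡ 0`.  So

  `sereginWang_liouville_L3_annulus → wangYang2026_liouville_velocity_log`

(`wangYang2026_liouville_velocity_log_of_sereginWang`): the PDE input (a pressure-free
Caccioppoli inequality via Bogovskii's operator — Seregin–Wang's proof, or Wang–Yang's Lemma 4.1)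
is exactly what the remaining named fact carries.

## The estimate (Wang–Yang 2026, (4.8)–(4.11), discretised dyadically)
Split the spherical annulus `S_R = {R/2 ≤ |x| < R}` at the cylindrical radius `r = 2^{k₀}`:
* inner part `r < 2^{k₀}`: it lies in the coordinate box `[-2^{k₀}, 2^{k₀}]² × [-R, R]` of volume
  `8 · 4^{k₀} R`, and `|u| ≤ η` there once `R/2` exceeds the decay radius of `η` ((4.8)–(4.9));
* outer part: covered by the dyadic shells `2^k ≤ r < 2^{k+1}`, `k ≥ k₀`, each inside the box
  `[-2^{k+1}, 2^{k+1}]² × [-R, R]` of volume `32 · 4^k R`, on which (1.13) gives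
  `|u|³ ≤ C³ 4^{-k} [log(e + 2^k)]^{-3γ}`; the shell sum is
  `R · Σ_{k ≥ k₀} 32 C³ [log(e+2^k)]^{-3γ}`,
  a convergent `p`-series tail since `3γ > 1` ((4.11) with `∫₁^∞ r H(r)³ dr < ∞`).
Hence `R⁻¹ ∫_{S_R} |u|³ ≤ 8·4^{k₀} η³ + Σ_{k ≥ k₀} (…) → 0`, i.e. `M(R)³ → 0`.  No measurability is
needed anywhere (outer integrals and monotonicity only).
-/

noncomputable section

namespace Literature.Analysis.FluidPDE

open _root_.MeasureTheory _root_.Filter _root_.Set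
open scoped ENNReal NNReal Topology

namespace WangYang2026

/-! The physical space `ℝ³` is `EuclideanSpace ℝ (Fin 3)`; `u` is the velocity field
throughout.  No notation and no auxiliary definitions are introduced (pure-proof file): the
coordinate box `[-a, a]² × [-b, b]` is written `WithLp.ofLp ⁻¹' Icc ![-a, -a, -b] ![a, a, b]`, the
spherical annulus `S_R` as `{x | R / 2 ≤ ‖x‖ ∧ ‖x‖ < R}` (literally the set in `sereginWangL3`)
and the dyadic cylindrical shells as `{x | 2 ^ k ≤ cylRadius x ∧ cylRadius x < 2 ^ (k + 1)}`. -/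
variable {u : EuclideanSpace ℝ (Fin 3) → EuclideanSpace ℝ (Fin 3)}

/-! ### Coordinate boxes and their volume; elementary inequalities -/

/-- A point at distance `≤ a` from the axis and of norm `≤ b` lies in the coordinate box
`[-a, a]² × [-b, b]` (preimage of an order interval of `Fin 3 → ℝ` under the coordinate map):
`|x₀|, |x₁| ≤ r = √(x₀² + x₁²)` and `|x₂| ≤ |x|`. [folklore] -/
theorem mem_cylBox {a b : ℝ} {x : EuclideanSpace ℝ (Fin 3)} (ha : cylRadius x ≤ a)
    (hb : ‖x‖ ≤ b) :
    x ∈ (WithLp.ofLp ⁻¹' Icc ![-a, -a, -b] ![a, a, b] : Set (EuclideanSpace ℝ (Fin 3))) := by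
  unfold cylRadius at ha
  have h0 : |x 0| ≤ a := (Real.abs_le_sqrt (by nlinarith [sq_nonneg (x 1)])).trans ha
  have h1 : |x 1| ≤ a := (Real.abs_le_sqrt (by nlinarith [sq_nonneg (x 0)])).trans ha
  have h2 : |x 2| ≤ b := le_trans (by simpa using PiLp.norm_apply_le x 2) hb
  rw [abs_le] at h0 h1 h2
  refine ⟨fun i => ?_, fun i => ?_⟩ <;> fin_cases i <;> simp <;> linarith

/-- `vol([-a, a]² × [-b, b]) = 2a · 2a · 2b` (Lebesgue measure on `ℝ³` is the product measure
under the coordinate map, `PiLp.volume_preserving_ofLp`). [folklore] -/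
theorem volume_cylBox {a : ℝ} (b : ℝ) (ha : 0 ≤ a) :
    volume (WithLp.ofLp ⁻¹' Icc ![-a, -a, -b] ![a, a, b] : Set (EuclideanSpace ℝ (Fin 3))) =
      ENNReal.ofReal (2 * a * (2 * a) * (2 * b)) := by
  rw [(PiLp.volume_preserving_ofLp (Fin 3)).measure_preimage
      measurableSet_Icc.nullMeasurableSet, Real.volume_Icc_pi, Fin.prod_univ_three]
  simp only [Matrix.cons_val_zero, Matrix.cons_val_one, Matrix.cons_val_two, Matrix.head_cons,
    Matrix.tail_cons, sub_neg_eq_add]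
  rw [← ENNReal.ofReal_mul (by positivity), ← ENNReal.ofReal_mul (by positivity)]
  congr 1
  ring

/-- `0 < log(e + t)` for `t ≥ 0` (as `e + t > 1`). [folklore] -/
theorem log_exp_one_add_pos {t : ℝ} (ht : 0 ≤ t) : 0 < Real.log (Real.exp 1 + t) :=
  Real.log_pos (by linarith [Real.add_one_le_exp (1 : ℝ)])

/-- Dyadic covering `S ⊆ (S ∩ {r < 2^{k₀}}) ∪ ⋃_{j} (S ∩ {2^{j+k₀} ≤ r < 2^{j+k₀+1}})` of any set
`S` by the cylindrical radius `r`. [folklore] -/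
theorem subset_inner_union_shells (S : Set (EuclideanSpace ℝ (Fin 3))) (k₀ : ℕ) :
    S ⊆ (S ∩ {x | cylRadius x < 2 ^ k₀}) ∪ ⋃ j : ℕ,
      (S ∩ {x | 2 ^ (j + k₀) ≤ cylRadius x ∧ cylRadius x < 2 ^ (j + k₀ + 1)}) := by
  intro x hx
  by_cases h : cylRadius x < 2 ^ k₀
  · exact Or.inl ⟨hx, h⟩
  · right
    replace h : (2 : ℝ) ^ k₀ ≤ cylRadius x := not_lt.1 h
    have h1 : (1 : ℝ) ≤ cylRadius x := le_trans (one_le_pow₀ (by norm_num)) h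
    obtain ⟨n, hn, hn'⟩ := exists_nat_pow_near h1 one_lt_two
    have hk : k₀ ≤ n :=
      Nat.lt_succ_iff.mp ((pow_lt_pow_iff_right₀ one_lt_two).1 (lt_of_le_of_lt h hn'))
    refine mem_iUnion.2 ⟨n - k₀, hx, ?_, ?_⟩ <;> rwa [Nat.sub_add_cancel hk]

/-! ### The inner part (4.8)–(4.9) and the dyadic shells (4.11) of Wang–Yang 2026 -/

/-- Inner estimate: if `|u| ≤ η` outside the ball of radius `ρ` and `R > 2ρ`, then
`∫_{S_R ∩ {r < 2^{k₀}}} |u|³ ≤ η³ · vol([-2^{k₀}, 2^{k₀}]² × [-R, R]) = η³ · 8 · 4^{k₀} R`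
(Wang–Yang 2026, (4.9): `R⁻¹ ∫_{A_R^{in}} |u|³ ≤ C r_*² ε_R³`). [cite: WangYang2026, (4.9)] -/
theorem lintegral_inner_le {η ρ R : ℝ} (hη : 0 ≤ η) (hρ : ∀ x, ρ < ‖x‖ → ‖u x‖ ≤ η)
    (hR : 2 * ρ < R) (k₀ : ℕ) :
    ∫⁻ x in {x | R / 2 ≤ ‖x‖ ∧ ‖x‖ < R} ∩ {x | cylRadius x < 2 ^ k₀}, ‖u x‖ₑ ^ 3 ≤
      ENNReal.ofReal (η ^ 3 * (2 * 2 ^ k₀ * (2 * 2 ^ k₀) * (2 * R))) := by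
  calc ∫⁻ x in {x | R / 2 ≤ ‖x‖ ∧ ‖x‖ < R} ∩ {x | cylRadius x < 2 ^ k₀}, ‖u x‖ₑ ^ 3
      ≤ ∫⁻ _ in {x | R / 2 ≤ ‖x‖ ∧ ‖x‖ < R} ∩ {x | cylRadius x < 2 ^ k₀},
          ENNReal.ofReal (η ^ 3) := by
        refine setLIntegral_mono measurable_const fun x hx => ?_
        have hxρ : ρ < ‖x‖ := by linarith [hx.1.1]
        rw [← ofReal_norm, ← ENNReal.ofReal_pow (norm_nonneg _)]
        exact ENNReal.ofReal_le_ofReal (pow_le_pow_left₀ (norm_nonneg _) (hρ x hxρ) 3)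
    _ = ENNReal.ofReal (η ^ 3) *
          volume ({x | R / 2 ≤ ‖x‖ ∧ ‖x‖ < R} ∩ {x | cylRadius x < 2 ^ k₀}) :=
        setLIntegral_const _ _
    _ ≤ ENNReal.ofReal (η ^ 3) * volume (WithLp.ofLp ⁻¹'
          Icc ![-2 ^ k₀, -2 ^ k₀, -R] ![2 ^ k₀, 2 ^ k₀, R] : Set (EuclideanSpace ℝ (Fin 3))) := by
        exact mul_le_mul' le_rfl (measure_mono fun x hx => mem_cylBox hx.2.le hx.1.2.le)
    _ = ENNReal.ofReal (η ^ 3 * (2 * 2 ^ k₀ * (2 * 2 ^ k₀) * (2 * R))) := by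
        rw [volume_cylBox R (by positivity), ← ENNReal.ofReal_mul (by positivity)]

/-- Shell estimate: under (1.13) (`C, γ ≥ 0`), on the dyadic shell `2^k ≤ r < 2^{k+1}` one has
`|u|³ ≤ C³ / (4^k [log(e + 2^k)]^{3γ})`, and the part of the shell inside `S_R` has volume
`≤ 32 · 4^k R`; so `∫_{S_R ∩ shell_k} |u|³ ≤ R · 32 C³ [log(e + 2^k)]^{-3γ}` (dyadic form of
Wang–Yang 2026, (4.11): `R⁻¹ ∫_{A_R^{out}} |u|³ ≤ C ∫ r H(r)³ dr`). [cite: WangYang2026, (4.11)] -/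
theorem lintegral_shell_le {C γ : ℝ} (hC : 0 ≤ C) (hγ : 0 ≤ γ)
    (hdec : ∀ x, 1 ≤ cylRadius x →
      ‖u x‖ ≤ C / (cylRadius x ^ (2 / 3 : ℝ) * Real.log (Real.exp 1 + cylRadius x) ^ γ))
    {R : ℝ} (hR0 : 0 ≤ R) (k : ℕ) :
    ∫⁻ x in {x | R / 2 ≤ ‖x‖ ∧ ‖x‖ < R} ∩ {x | 2 ^ k ≤ cylRadius x ∧ cylRadius x < 2 ^ (k + 1)},
        ‖u x‖ₑ ^ 3 ≤
      ENNReal.ofReal R *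
        ENNReal.ofReal (32 * C ^ 3 / Real.log (Real.exp 1 + 2 ^ k) ^ (3 * γ)) := by
  set L : ℝ := Real.log (Real.exp 1 + 2 ^ k) with hL
  have hLpos : 0 < L := log_exp_one_add_pos (by positivity)
  set M : ℝ := C ^ 3 / ((2 ^ k) ^ 2 * L ^ (3 * γ)) with hM
  have hM0 : 0 ≤ M := div_nonneg (by positivity) (by positivity)
  calc ∫⁻ x in {x | R / 2 ≤ ‖x‖ ∧ ‖x‖ < R} ∩
          {x | 2 ^ k ≤ cylRadius x ∧ cylRadius x < 2 ^ (k + 1)}, ‖u x‖ₑ ^ 3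
      ≤ ∫⁻ _ in {x | R / 2 ≤ ‖x‖ ∧ ‖x‖ < R} ∩
          {x | 2 ^ k ≤ cylRadius x ∧ cylRadius x < 2 ^ (k + 1)}, ENNReal.ofReal M := by
        refine setLIntegral_mono measurable_const fun x hx => ?_
        obtain ⟨-, hk1, -⟩ := hx
        have h1r : (1 : ℝ) ≤ cylRadius x := le_trans (one_le_pow₀ (by norm_num)) hk1
        have hrpos : 0 < cylRadius x := one_pos.trans_le h1r
        have hL0 : 0 < Real.log (Real.exp 1 + cylRadius x) := log_exp_one_add_pos hrpos.le
        have hLr : L ≤ Real.log (Real.exp 1 + cylRadius x) :=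
          Real.log_le_log (by positivity) (by linarith)
        have e1 : (cylRadius x ^ (2 / 3 : ℝ)) ^ (3 : ℕ) = cylRadius x ^ (2 : ℕ) := by
          rw [← Real.rpow_natCast, ← Real.rpow_mul hrpos.le]; norm_num
        have e2 : (Real.log (Real.exp 1 + cylRadius x) ^ γ) ^ (3 : ℕ) =
            Real.log (Real.exp 1 + cylRadius x) ^ (3 * γ) := by
          rw [← Real.rpow_natCast, ← Real.rpow_mul hL0.le, mul_comm]; norm_num
        have hux3 : ‖u x‖ ^ 3 ≤
            C ^ 3 / (cylRadius x ^ (2 : ℕ) * Real.log (Real.exp 1 + cylRadius x) ^ (3 * γ)) :=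
          calc ‖u x‖ ^ 3
              ≤ (C / (cylRadius x ^ (2 / 3 : ℝ) * Real.log (Real.exp 1 + cylRadius x) ^ γ)) ^ 3 :=
                pow_le_pow_left₀ (norm_nonneg _) (hdec x h1r) 3
            _ = C ^ 3 / (cylRadius x ^ (2 : ℕ) *
                  Real.log (Real.exp 1 + cylRadius x) ^ (3 * γ)) := by
                rw [div_pow, mul_pow, e1, e2]
        have hM' : C ^ 3 / (cylRadius x ^ (2 : ℕ) * Real.log (Real.exp 1 + cylRadius x) ^ (3 * γ))
            ≤ M := by
          rw [hM]
          apply div_le_div_of_nonneg_left (by positivity) (by positivity)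
          exact mul_le_mul (pow_le_pow_left₀ (by positivity) hk1 2)
            (Real.rpow_le_rpow hLpos.le hLr (by positivity)) (by positivity) (by positivity)
        rw [← ofReal_norm, ← ENNReal.ofReal_pow (norm_nonneg _)]
        exact ENNReal.ofReal_le_ofReal (hux3.trans hM')
    _ = ENNReal.ofReal M * volume ({x | R / 2 ≤ ‖x‖ ∧ ‖x‖ < R} ∩
          {x | 2 ^ k ≤ cylRadius x ∧ cylRadius x < 2 ^ (k + 1)}) := setLIntegral_const _ _
    _ ≤ ENNReal.ofReal M * volume (WithLp.ofLp ⁻¹' Icc ![-2 ^ (k + 1), -2 ^ (k + 1), -R]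
          ![2 ^ (k + 1), 2 ^ (k + 1), R] : Set (EuclideanSpace ℝ (Fin 3))) := by
        exact mul_le_mul' le_rfl (measure_mono fun x hx => mem_cylBox hx.2.2.le hx.1.2.le)
    _ = ENNReal.ofReal R * ENNReal.ofReal (32 * C ^ 3 / L ^ (3 * γ)) := by
        rw [volume_cylBox R (by positivity), ← ENNReal.ofReal_mul hM0,
          ← ENNReal.ofReal_mul hR0]
        congr 1
        rw [hM, pow_succ]
        field_simp
        ring

/-! ### Summability of the shell bounds (`3γ > 1`) -/

/-- The shell bounds `A / [log(e + 2^k)]^{3γ}` are summable for `γ > 1/3`: for `k ≥ 1`,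
`log(e + 2^k) ≥ k log 2`, so they are dominated by the `p`-series `k^{-3γ}`, `3γ > 1`
(Wang–Yang 2026, proof of Thm 1.5: `∫₁^∞ dr / (r [log(e+r)]^{3γ}) < ∞` iff `3γ > 1`).
[cite: WangYang2026, proof of Thm 1.5 (p. 21)] -/
theorem summable_shellBound {A γ : ℝ} (hA : 0 ≤ A) (hγ : 1 / 3 < γ) :
    Summable fun k : ℕ => A / Real.log (Real.exp 1 + 2 ^ k) ^ (3 * γ) := by
  have h3γ : 1 < 3 * γ := by linarith
  have hlog2 : 0 < Real.log 2 := Real.log_pos one_lt_two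
  have hg : Summable fun k : ℕ => A * (Real.log 2 ^ (3 * γ))⁻¹ * ((k : ℝ) ^ (3 * γ))⁻¹ :=
    (Real.summable_nat_rpow_inv.2 h3γ).mul_left _
  refine hg.of_norm_bounded_eventually ?_
  rw [Nat.cofinite_eq_atTop]
  filter_upwards [eventually_ge_atTop 1] with k hk
  have hk1 : (1 : ℝ) ≤ k := by exact_mod_cast hk
  have hLk : (k : ℝ) * Real.log 2 ≤ Real.log (Real.exp 1 + 2 ^ k) := by
    rw [← Real.log_pow]
    exact Real.log_le_log (by positivity) (by linarith [Real.exp_pos 1])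
  have hkpos : 0 < (k : ℝ) * Real.log 2 := by positivity
  rw [Real.norm_of_nonneg (div_nonneg hA (Real.rpow_nonneg (hkpos.le.trans hLk) _))]
  calc A / Real.log (Real.exp 1 + 2 ^ k) ^ (3 * γ)
      ≤ A / ((k : ℝ) * Real.log 2) ^ (3 * γ) := by
        apply div_le_div_of_nonneg_left hA (Real.rpow_pos_of_pos hkpos _)
        exact Real.rpow_le_rpow hkpos.le hLk (by linarith)
    _ = A * (Real.log 2 ^ (3 * γ))⁻¹ * ((k : ℝ) ^ (3 * γ))⁻¹ := by
        rw [Real.mul_rpow (by positivity) hlog2.le, div_eq_mul_inv, mul_inv]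
        ring

/-- The shell bounds have a finite sum in `ℝ≥0∞`. [folklore] -/
theorem tsum_shellBound_ne_top {A γ : ℝ} (hA : 0 ≤ A) (hγ : 1 / 3 < γ) :
    ∑' k : ℕ, ENNReal.ofReal (A / Real.log (Real.exp 1 + 2 ^ k) ^ (3 * γ)) ≠ ∞ := by
  rw [← ENNReal.ofReal_tsum_of_nonneg (fun k => div_nonneg hA
    (Real.rpow_nonneg (log_exp_one_add_pos (by positivity)).le _)) (summable_shellBound hA hγ)]
  exact ENNReal.ofReal_ne_top

/-! ### `R⁻¹ ∫_{S_R} |u|³ → 0` (Wang–Yang 2026, proof of Prop. 1.4) -/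

/-- A radius beyond which `|u| ≤ η`, from `u → 0` at infinity. [folklore] -/
theorem exists_radius_norm_le (hlim : Tendsto u (cocompact _) (𝓝 0)) {η : ℝ} (hη : 0 < η) :
    ∃ ρ : ℝ, ∀ x, ρ < ‖x‖ → ‖u x‖ ≤ η := by
  have h1 : ∀ᶠ x in cocompact _, u x ∈ Metric.ball (0 : EuclideanSpace ℝ (Fin 3)) η :=
    hlim.eventually_mem (Metric.ball_mem_nhds 0 hη)
  obtain ⟨t, ht, hts⟩ := mem_cocompact.1 h1
  obtain ⟨ρ, hρ⟩ := ht.isBounded.subset_closedBall 0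
  refine ⟨ρ, fun x hx => le_of_lt ?_⟩
  have hxt : x ∉ t := fun hxt => by linarith [mem_closedBall_zero_iff.1 (hρ hxt)]
  simpa using hts hxt

/-- **Wang–Yang 2026, proof of Prop. 1.4 / Thm 1.5 (the limiting estimate).**  Under `u → 0` at
infinity and (1.13) with `γ > 1/3`, `R⁻¹ ∫_{R/2 ≤ |x| < R} |u|³ dx → 0` as `R → ∞`
(combining (4.9) for the inner part `r < r_*` with (4.11) for the outer part and letting first
`R → ∞`, then `r_* → ∞`). [cite: WangYang2026, Prop. 1.4 (proof, (4.8)–(4.11)) and Thm 1.5] -/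
theorem tendsto_annular_lintegral_zero (hlim : Tendsto u (cocompact _) (𝓝 0))
    (hdec : ∃ C γ : ℝ, 1 / 3 < γ ∧ ∀ x, 1 ≤ cylRadius x →
      ‖u x‖ ≤ C / (cylRadius x ^ (2 / 3 : ℝ) * Real.log (Real.exp 1 + cylRadius x) ^ γ)) :
    Tendsto (fun R : ℝ => ENNReal.ofReal R⁻¹ *
      ∫⁻ x in {x | R / 2 ≤ ‖x‖ ∧ ‖x‖ < R}, ‖u x‖ₑ ^ 3) atTop (𝓝 0) := by
  obtain ⟨C, γ, hγ, hdec⟩ := hdec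
  set C₀ : ℝ := max C 0 with hC₀
  have hC₀0 : 0 ≤ C₀ := le_max_right _ _
  have hdec' : ∀ x, 1 ≤ cylRadius x →
      ‖u x‖ ≤ C₀ / (cylRadius x ^ (2 / 3 : ℝ) * Real.log (Real.exp 1 + cylRadius x) ^ γ) :=
    fun x hx => (hdec x hx).trans (div_le_div_of_nonneg_right (le_max_left _ _) (mul_pos
      (Real.rpow_pos_of_pos (one_pos.trans_le hx) _)
      (Real.rpow_pos_of_pos (log_exp_one_add_pos (zero_le_one.trans hx)) _)).le)
  set b : ℕ → ℝ≥0∞ := fun k =>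
    ENNReal.ofReal (32 * C₀ ^ 3 / Real.log (Real.exp 1 + 2 ^ k) ^ (3 * γ)) with hb
  have hbsum : ∑' k, b k ≠ ∞ := tsum_shellBound_ne_top (by positivity) hγ
  rw [ENNReal.tendsto_nhds_zero]
  intro ε hε
  rcases eq_or_ne ε ∞ with rfl | hεtop
  · exact Eventually.of_forall fun _ => le_top
  have hδ : 0 < ε.toReal := ENNReal.toReal_pos hε.ne' hεtop
  set δ : ℝ := ε.toReal with hδdef
  -- (1) the tail of the shell series
  obtain ⟨k₀, hk₀⟩ := ENNReal.tendsto_atTop_zero.1 (ENNReal.tendsto_sum_nat_add b hbsum)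
    (ENNReal.ofReal (δ / 2)) (by simpa using hδ)
  have htail : ∑' j, b (j + k₀) ≤ ENNReal.ofReal (δ / 2) := hk₀ k₀ le_rfl
  -- (2) the size `η` of `u` on the inner part
  set V : ℝ := 2 * 2 ^ k₀ * (2 * 2 ^ k₀) * 2 with hV
  have hVpos : 0 < V := by positivity
  set η : ℝ := min 1 (δ / 2 / V) with hη
  have hηpos : 0 < η := lt_min one_pos (by positivity)
  have hηV : η ^ 3 * V ≤ δ / 2 :=
    calc η ^ 3 * V ≤ η * V := by
          gcongr; exact pow_le_of_le_one hηpos.le (min_le_left _ _) three_ne_zero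
      _ ≤ δ / 2 / V * V := by gcongr; exact min_le_right _ _
      _ = δ / 2 := div_mul_cancel₀ _ hVpos.ne'
  -- (3) the decay radius
  obtain ⟨ρ, hρ⟩ := exists_radius_norm_le hlim hηpos
  -- (4) conclusion for `R > max (2ρ) 0`
  filter_upwards [eventually_gt_atTop (2 * ρ), eventually_gt_atTop (0 : ℝ)] with R hRρ hR0
  set S : Set (EuclideanSpace ℝ (Fin 3)) := {x | R / 2 ≤ ‖x‖ ∧ ‖x‖ < R} with hS
  have hI : ∫⁻ x in S, ‖u x‖ₑ ^ 3 ≤ ENNReal.ofReal R * ENNReal.ofReal δ :=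
    calc ∫⁻ x in S, ‖u x‖ₑ ^ 3
        ≤ ∫⁻ x in (S ∩ {x | cylRadius x < 2 ^ k₀}) ∪ ⋃ j : ℕ,
            (S ∩ {x | 2 ^ (j + k₀) ≤ cylRadius x ∧ cylRadius x < 2 ^ (j + k₀ + 1)}),
            ‖u x‖ₑ ^ 3 :=
          lintegral_mono_set (subset_inner_union_shells S k₀)
      _ ≤ (∫⁻ x in S ∩ {x | cylRadius x < 2 ^ k₀}, ‖u x‖ₑ ^ 3) + ∫⁻ x in ⋃ j : ℕ,
            (S ∩ {x | 2 ^ (j + k₀) ≤ cylRadius x ∧ cylRadius x < 2 ^ (j + k₀ + 1)}),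
            ‖u x‖ₑ ^ 3 :=
          lintegral_union_le _ _ _
      _ ≤ ENNReal.ofReal (η ^ 3 * (2 * 2 ^ k₀ * (2 * 2 ^ k₀) * (2 * R))) + ∑' j : ℕ, ∫⁻ x in
            S ∩ {x | 2 ^ (j + k₀) ≤ cylRadius x ∧ cylRadius x < 2 ^ (j + k₀ + 1)}, ‖u x‖ₑ ^ 3 :=
          add_le_add (lintegral_inner_le hηpos.le hρ hRρ k₀) (lintegral_iUnion_le _ _)
      _ ≤ ENNReal.ofReal (η ^ 3 * (2 * 2 ^ k₀ * (2 * 2 ^ k₀) * (2 * R))) +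
            ∑' j, ENNReal.ofReal R * b (j + k₀) :=
          add_le_add le_rfl (ENNReal.tsum_le_tsum fun j =>
            lintegral_shell_le hC₀0 (by linarith) hdec' hR0.le (j + k₀))
      _ = ENNReal.ofReal R * (ENNReal.ofReal (η ^ 3 * V) + ∑' j, b (j + k₀)) := by
          rw [ENNReal.tsum_mul_left, mul_add, ← ENNReal.ofReal_mul hR0.le]
          congr 2
          rw [hV]
          ring
      _ ≤ ENNReal.ofReal R * (ENNReal.ofReal (δ / 2) + ENNReal.ofReal (δ / 2)) :=
          mul_le_mul' le_rfl (add_le_add (ENNReal.ofReal_le_ofReal hηV) htail)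
      _ = ENNReal.ofReal R * ENNReal.ofReal δ := by
          rw [← ENNReal.ofReal_add (by positivity) (by positivity), add_halves]
  calc ENNReal.ofReal R⁻¹ * ∫⁻ x in S, ‖u x‖ₑ ^ 3
      ≤ ENNReal.ofReal R⁻¹ * (ENNReal.ofReal R * ENNReal.ofReal δ) := mul_le_mul' le_rfl hI
    _ = ε := by
        rw [← mul_assoc, ← ENNReal.ofReal_mul (inv_nonneg.2 hR0.le), inv_mul_cancel₀ hR0.ne',
          ENNReal.ofReal_one, one_mul, hδdef, ENNReal.ofReal_toReal hεtop]

/-! ### The annular `L³` quantity tends to zero -/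

/-- `R^{-1/3} (∫_{S_R} |u|³)^{1/3} = (R⁻¹ ∫_{S_R} |u|³)^{1/3}` for `R > 0`. [folklore] -/
theorem annularL3_eq_rpow (u : EuclideanSpace ℝ (Fin 3) → EuclideanSpace ℝ (Fin 3)) {R : ℝ}
    (hR : 0 < R) (S : Set (EuclideanSpace ℝ (Fin 3))) :
    ENNReal.ofReal (R ^ (-(1 / 3 : ℝ))) * (∫⁻ x in S, ‖u x‖ₑ ^ (3 : ℝ)) ^ (1 / 3 : ℝ) =
      (ENNReal.ofReal R⁻¹ * ∫⁻ x in S, ‖u x‖ₑ ^ 3) ^ (1 / 3 : ℝ) := by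
  have hpow : ENNReal.ofReal (R ^ (-(1 / 3 : ℝ))) = ENNReal.ofReal R⁻¹ ^ (1 / 3 : ℝ) := by
    rw [ENNReal.ofReal_rpow_of_nonneg (inv_nonneg.2 hR.le) (by norm_num), Real.inv_rpow hR.le,
      Real.rpow_neg hR.le]
  rw [hpow, ← ENNReal.mul_rpow_of_nonneg _ _ (by norm_num)]
  simp only [ENNReal.rpow_ofNat]

/-- **Wang–Yang 2026 ⇒ Seregin–Wang's hypothesis with `lim inf = 0`** (generic form).  Under
`u → 0` at infinity and the log-improved cylindrical decay (1.13) with `γ > 1/3`, the annular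
quantity `R^{-1/3} ‖u‖_{L³(R/2 ≤ |x| < R)}` tends to `0` as `R → ∞` (Wang–Yang 2026, proofs of
Prop. 1.4 and Thm 1.5, pp. 20–21, plus a cube root).
[cite: WangYang2026, Prop. 1.4 and Thm 1.5 (proofs, pp. 20–21)] -/
theorem tendsto_annularL3_zero (hlim : Tendsto u (cocompact _) (𝓝 0))
    (hdec : ∃ C γ : ℝ, 1 / 3 < γ ∧ ∀ x, 1 ≤ cylRadius x →
      ‖u x‖ ≤ C / (cylRadius x ^ (2 / 3 : ℝ) * Real.log (Real.exp 1 + cylRadius x) ^ γ)) :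
    Tendsto (fun R : ℝ => ENNReal.ofReal (R ^ (-(1 / 3 : ℝ))) *
      (∫⁻ x in {x | R / 2 ≤ ‖x‖ ∧ ‖x‖ < R}, ‖u x‖ₑ ^ (3 : ℝ)) ^ (1 / 3 : ℝ)) atTop (𝓝 0) := by
  have h := tendsto_annular_lintegral_zero hlim hdec
  have h' : Tendsto (fun R : ℝ => (ENNReal.ofReal R⁻¹ *
      ∫⁻ x in {x | R / 2 ≤ ‖x‖ ∧ ‖x‖ < R}, ‖u x‖ₑ ^ 3) ^ (1 / 3 : ℝ)) atTop (𝓝 0) := by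
    have := ((ENNReal.continuous_rpow_const (y := 1 / 3)).tendsto 0).comp h
    rwa [ENNReal.zero_rpow_of_pos (by norm_num : (0 : ℝ) < 1 / 3)] at this
  refine h'.congr' ?_
  filter_upwards [eventually_gt_atTop (0 : ℝ)] with R hR
  exact (annularL3_eq_rpow u hR _).symm

/-- Unfolding the `L³` seminorm in `sereginWangL3`: `M(R) = R^{-1/3} (∫_{S_R} |u|³)^{1/3}`.
[folklore] -/
theorem sereginWangL3_eq (u : EuclideanSpace ℝ (Fin 3) → EuclideanSpace ℝ (Fin 3)) (R : ℝ) :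
    sereginWangL3 u R = ENNReal.ofReal (R ^ (-(1 / 3 : ℝ))) *
      (∫⁻ x in {x | R / 2 ≤ ‖x‖ ∧ ‖x‖ < R}, ‖u x‖ₑ ^ (3 : ℝ)) ^ (1 / 3 : ℝ) := by
  have h3 : (3 : ℝ≥0∞).toReal = 3 := by norm_num
  rw [sereginWangL3, eLpNorm_eq_lintegral_rpow_enorm_toReal (by norm_num) (by norm_num), h3]

/-- **Seregin–Wang's quantity tends to zero** under the hypotheses of Wang–Yang's Thm 1.5:
`M(R) = R^{-1/3} ‖u‖_{L³(B_R ∖ B_{R/2})} → 0` (`R → ∞`), in particular `lim inf_R M(R) = 0`.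
[cite: WangYang2026, Prop. 1.4 and Thm 1.5 (proofs, pp. 20–21)] -/
theorem tendsto_sereginWangL3_zero (hlim : Tendsto u (cocompact _) (𝓝 0))
    (hdec : ∃ C γ : ℝ, 1 / 3 < γ ∧ ∀ x, 1 ≤ cylRadius x →
      ‖u x‖ ≤ C / (cylRadius x ^ (2 / 3 : ℝ) * Real.log (Real.exp 1 + cylRadius x) ^ γ)) :
    Tendsto (sereginWangL3 u) atTop (𝓝 0) :=
  (tendsto_annularL3_zero hlim hdec).congr fun R => (sereginWangL3_eq u R).symm

end WangYang2026

/-! ### The reduction -/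

/-- **Wang–Yang 2026, Thm 1.5 from Seregin–Wang 2020, Thm 1.1 (`q = ℓ = 3`).**  The named fact
`sereginWang_liouville_L3_annulus` implies the named fact `wangYang2026_liouville_velocity_log`:
for a smooth steady solution with `u → 0` at infinity satisfying (1.13) with `γ > 1/3`,
`lim inf_R R^{-1/3}‖u‖_{L³(B_R∖B_{R/2})} = 0` (`WangYang2026.tendsto_sereginWangL3_zero`), so
Seregin–Wang's smallness clause holds trivially and `u ≡ 0` (as in Wang 2025, Remark 2.3 (2);
Tsai 2021, Thm 1.1 (a)).  The finite-Dirichlet-integral hypothesis (1.2) is not even used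
(Seregin–Wang's (2.13) supplies it).  This is Wang–Yang's proof of Thm 1.5 via Prop. 1.4 with the
pressure-free Caccioppoli inequality (their Lemma 4.1) replaced by Seregin–Wang's theorem.
[cite: WangYang2026, Thm 1.5 (proof, p. 21)] -/
theorem wangYang2026_liouville_velocity_log_of_sereginWang
    (h : sereginWang_liouville_L3_annulus) : wangYang2026_liouville_velocity_log := by
  intro u p hprof hu hp _ hlim hdec
  obtain ⟨c, δ, _, H⟩ := h
  have h0 : liminf (sereginWangL3 u) atTop = 0 :=
    (WangYang2026.tendsto_sereginWangL3_zero hlim hdec).liminf_eq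
  have H' := H u p hprof hu hp (by rw [h0]; exact ENNReal.zero_lt_top)
  exact H'.2 (by rw [h0]; simp)

end Literature.Analysis.FluidPDE

end
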